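import Summits.BirchSwinnertonDyer.BirchSwinnertonDyer.Theorems.Rank1ResidualJetCoreVertexBridge
import HarnessLib

/-!
# T1 JET (cell `bsd-jet`), road K: the ring class fields `K[k]` are number fields for EVERY `k`
# (including the degenerate `k = 0`), and the hypothesis `hRCF` of the core-vertex bridge DISCHARGED

HONEST FRAMING (programme file §HONESTY, verbatim): «no tranche here proves BSD; ARM L moves the
LITERAL column of an r ≤ 1 census into the kernel-proved-modulo-named-print column.» THEOREMS ONLY
(seat `bsd-jet-pv-2`, session g2; `--supports stmt-BirchSwinnertonDyer-14418`, helper); 0 classes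
move. The typed Prop. 5.3 (`Jetchev2008.prop53_…`, p485508) and its reading K5
(`JET.JetchevCoreVertexExistence`, p487481) carry the instance binder
`[∀ k : ℕ, NumberField (ringClassField K ι k)]`; the tree proves `K[n]/K` finite Galois for `n ≠ 0`
(`finiteDimensional_and_isGalois_ringClassField`). Here: `reducedForms 0 = ∅` (no reduced form has
outer coefficient in `[1, 0]`), so `K[0] = ι(K)(∅)` is finite over `K` too
(`finiteDimensional_ringClassField_zero`), hence `numberField_ringClassField : ∀ k, NumberField (K[k])`,
and the corollaries of `Rank1ResidualJetCoreVertexBridge.lean` lose their hypothesis `hRCF`: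
`jetchevDivisibilityCarrier{Mult,Ne,Add}_of_prop52_of_coreVertexExistence'` — K3 ∕ K1 ∕ K4 ⟸
McCallum 1991 Prop. 5.2 (typed) + K5 + H63 (printed Thm. 5.2 instantiated). Elementary.
References: [cite: Cox2013, §2.A (reduced forms), §9.A (ring class fields)]
[cite: Jetchev2008, Prop. 5.3 (p. 823), Thm. 5.2 (p. 821)] [cite: McCallumLMS1991, §5 Prop. 5.2 (p. 304)].
-/

set_option autoImplicit false

noncomputable section

open scoped Classical

open Polynomial WeierstrassCurve Literature.NumberTheory.EllipticCurves
  Literature.NumberTheory.EllipticCurves.ModularForms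
  Literature.NumberTheory.QuadraticFields.BinaryQuadraticForm

namespace Summit.BirchSwinnertonDyer.Rank1Residual.JET

/-- There is no reduced form of discriminant `0` in the tree's enumeration (the outer coefficient
ranges over `[1, |0|/3] = ∅`). Elementary. [cite: Cox2013, §2.A Thm. 2.13] -/
theorem reducedForms_zero : reducedForms 0 = ∅ := by
  simp [reducedForms, coeffBound]

/-- The degenerate ring class "field of conductor `0`" of the tree, `K[0] = ι(K)(j(reduced forms of
discriminant 0)) = ι(K)`, is finite over `K` (there are no such forms). Same argument as
`finiteDimensional_and_isGalois_ringClassField` with the zero polynomial.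
[cite: Cox2013, §9.A (ring class fields)] -/
theorem finiteDimensional_ringClassField_zero (K : Type) [Field K] [NumberField K] (ι : K →+* ℂ) :
    FiniteDimensional K (ringClassField K ι 0) := by
  letI : Algebra K ℂ := ι.toAlgebra
  have hq : (0 : K[X]).rootSet ℂ = ↑(ringClassSingularModuli K 0) := by
    rw [rootSet_zero, ringClassSingularModuli]
    simp [reducedForms_zero]
  set M : IntermediateField K ℂ := IntermediateField.adjoin K ((0 : K[X]).rootSet ℂ) with hM_def
  have hMS : M.toSubfield = ringClassField K ι 0 := by
    rw [hM_def, IntermediateField.adjoin_toSubfield, hq]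
    rfl
  have hmem : ∀ x : ℂ, x ∈ M ↔ x ∈ ringClassField K ι 0 := fun x ↦ by
    rw [← hMS, IntermediateField.mem_toSubfield]
  haveI : (0 : K[X]).IsSplittingField K M :=
    IntermediateField.adjoin_rootSet_isSplittingField (IsAlgClosed.splits _)
  haveI : FiniteDimensional K M := Polynomial.IsSplittingField.finiteDimensional M (0 : K[X])
  let e : M ≃ₐ[K] ringClassField K ι 0 :=
    { toFun := fun x ↦ ⟨x.1, (hmem x.1).mp x.2⟩
      invFun := fun x ↦ ⟨x.1, (hmem x.1).mpr x.2⟩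
      left_inv := fun _ ↦ rfl
      right_inv := fun _ ↦ rfl
      map_mul' := fun _ _ ↦ rfl
      map_add' := fun _ _ ↦ rfl
      commutes' := fun _ ↦ rfl }
  exact LinearEquiv.finiteDimensional e.toLinearEquiv

/-- **Every ring class field `K[k]` of an imaginary quadratic `K` is a number field** (`k ≠ 0`: the
tree's `finiteDimensional_and_isGalois_ringClassField`; `k = 0`: `finiteDimensional_ringClassField_zero`)
— discharging the instance binder of `Jetchev2008.prop53_…` / `JET.JetchevCoreVertexExistence`.
[cite: Cox2013, §9.A (ring class fields)] -/
theorem numberField_ringClassField (K : Type) [Field K] [NumberField K] (hK : IsImaginaryQuadratic K)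
    (ι : K →+* ℂ) (k : ℕ) : NumberField (ringClassField K ι k) := by
  rcases eq_or_ne k 0 with rfl | hk
  · haveI := finiteDimensional_ringClassField_zero K ι
    exact NumberField.of_module_finite K _
  · haveI := (finiteDimensional_and_isGalois_ringClassField hK ι hk).1
    exact NumberField.of_module_finite K _

/-- **K3 ⟸ McCallum Prop. 5.2 + K5 + [J] Thm. 5.2 instantiated** — as
`jetchevDivisibilityCarrierMult_of_prop52_of_coreVertexExistence` with the ring-class-field hypothesis
discharged by `numberField_ringClassField`. [cite: Jetchev2008, Prop. 5.3 (p. 823), Thm. 5.2 (p. 821)]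
[cite: McCallumLMS1991, §5 Prop. 5.2 (p. 304)] -/
theorem jetchevDivisibilityCarrierMult_of_prop52_of_coreVertexExistence'
    (h52 : McCallum1991.prop52_exists_conductor_kolyvaginClass_order_eq)
    (hCV : JetchevCoreVertexExistence)
    (H63 : ∀ (W : WeierstrassCurve ℚ) [W.IsElliptic] [W.IsGloballyMinimal] [NeZero (W.conductorNorm ℤ)],
      ¬ W.HasCM → ∀ (K : Type) [Field K] [NumberField K], IsImaginaryQuadratic K →
      NumberField.discr K ≠ -3 → NumberField.discr K ≠ -4 →
      SatisfiesHeegnerHypothesis (W.conductorNorm ℤ) K →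
      ∀ (τ : K ≃ₐ[ℚ] K), τ ≠ 1 →
      ∀ (p : ℕ) [Fact p.Prime], p ≠ 2 → W.HasMultiplicativeReductionAtPrime p →
      (∀ n : ℕ, W.HasSurjectiveModNGaloisRep (p ^ n : ℕ)) →
      ∀ (Dt : ModularParametrizationData W (W.conductorNorm ℤ)) (β : ℤ) (ι : K →+* ℂ)
        [∀ k : ℕ, NumberField (ringClassField K ι k)]
        (d₁ : KolyvaginHeegnerData Dt β ι 1), ¬ IsOfFinAddOrder d₁.derivedPoint →
      ∀ (mdiv m : {c : ℕ // Squarefree c ∧ ∀ ℓ ∈ c.primeFactors,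
          Zhang2014.IsKolyvaginPrime (W.conductorNorm ℤ) W K p ℓ} → ℕ∞),
      (∀ c (u : ℕ), (u : ℕ∞) ≤ mdiv c ↔ ∀ d : KolyvaginHeegnerData Dt β ι c.1,
        ∃ Q : (W.baseChange (ringClassField K ι c.1)).toAffine.Point,
          ((p ^ u : ℕ) : ℤ) • Q = d.derivedPoint) →
      (∀ c, m c = if mdiv c < Zhang2014.levelIndex W p c.1 then mdiv c else ⊤) →
      ∀ mInf : ℕ, (∀ c, (mInf : ℕ∞) ≤ m c) →
        (∀ m' : ℕ, ∃ c, (m' : ℕ∞) ≤ Zhang2014.levelIndex W p c.1 ∧ m c = mInf) →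
      ∀ (k : ℕ) c, 1 ≤ k → Jetchev2008.IsGlobalCoreVertex W K ι τ p k c.1 → m c = mInf →
        (k : ℕ∞) + mInf ≤ Zhang2014.levelIndex W p c.1 →
        padicValNat p ((W.baseChange ℚ_[p]).localTamagawaNumber ℤ_[p]) < k → mInf < k →
        padicValNat p ((W.baseChange ℚ_[p]).localTamagawaNumber ℤ_[p]) ≤ mInf) :
    JetchevDivisibilityCarrierMult :=
  jetchevDivisibilityCarrierMult_of_prop52_of_coreVertexExistence h52 hCV
    (fun K _ _ ι hK ↦ numberField_ringClassField K hK ι) H63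

/-- **K1 ⟸ McCallum Prop. 5.2 + K5 + [J] Thm. 5.2 instantiated** (carrier `q ≠ p`), ring class
fields discharged. [cite: Jetchev2008, Prop. 5.3 (p. 823), Thm. 5.2 (p. 821)] [cite: McCallumLMS1991, §5 Prop. 5.2 (p. 304)] -/
theorem jetchevDivisibilityCarrierNe_of_prop52_of_coreVertexExistence'
    (h52 : McCallum1991.prop52_exists_conductor_kolyvaginClass_order_eq)
    (hCV : JetchevCoreVertexExistence)
    (H63 : ∀ (W : WeierstrassCurve ℚ) [W.IsElliptic] [W.IsGloballyMinimal] [NeZero (W.conductorNorm ℤ)],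
      ¬ W.HasCM → ∀ (K : Type) [Field K] [NumberField K], IsImaginaryQuadratic K →
      NumberField.discr K ≠ -3 → NumberField.discr K ≠ -4 →
      SatisfiesHeegnerHypothesis (W.conductorNorm ℤ) K →
      ∀ (τ : K ≃ₐ[ℚ] K), τ ≠ 1 →
      ∀ (p : ℕ) [Fact p.Prime], p ≠ 2 → (∀ n : ℕ, W.HasSurjectiveModNGaloisRep (p ^ n : ℕ)) →
      ∀ (Dt : ModularParametrizationData W (W.conductorNorm ℤ)) (β : ℤ) (ι : K →+* ℂ)
        [∀ k : ℕ, NumberField (ringClassField K ι k)]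
        (d₁ : KolyvaginHeegnerData Dt β ι 1), ¬ IsOfFinAddOrder d₁.derivedPoint →
      ∀ (q : ℕ) [Fact q.Prime], q ∣ W.conductorNorm ℤ → q ≠ p →
      ∀ (mdiv m : {c : ℕ // Squarefree c ∧ ∀ ℓ ∈ c.primeFactors,
          Zhang2014.IsKolyvaginPrime (W.conductorNorm ℤ) W K p ℓ} → ℕ∞),
      (∀ c (u : ℕ), (u : ℕ∞) ≤ mdiv c ↔ ∀ d : KolyvaginHeegnerData Dt β ι c.1,
        ∃ Q : (W.baseChange (ringClassField K ι c.1)).toAffine.Point,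
          ((p ^ u : ℕ) : ℤ) • Q = d.derivedPoint) →
      (∀ c, m c = if mdiv c < Zhang2014.levelIndex W p c.1 then mdiv c else ⊤) →
      ∀ mInf : ℕ, (∀ c, (mInf : ℕ∞) ≤ m c) →
        (∀ m' : ℕ, ∃ c, (m' : ℕ∞) ≤ Zhang2014.levelIndex W p c.1 ∧ m c = mInf) →
      ∀ (k : ℕ) c, 1 ≤ k → Jetchev2008.IsGlobalCoreVertex W K ι τ p k c.1 → m c = mInf →
        (k : ℕ∞) + mInf ≤ Zhang2014.levelIndex W p c.1 →
        padicValNat p ((W.baseChange ℚ_[q]).localTamagawaNumber ℤ_[q]) < k → mInf < k →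
        padicValNat p ((W.baseChange ℚ_[q]).localTamagawaNumber ℤ_[q]) ≤ mInf) :
    JetchevDivisibilityCarrierNe :=
  jetchevDivisibilityCarrierNe_of_prop52_of_coreVertexExistence h52 hCV
    (fun K _ _ ι hK ↦ numberField_ringClassField K hK ι) H63

/-- **K4 ⟸ McCallum Prop. 5.2 + K5 + [J] Thm. 5.2 instantiated** (carrier `p` additive), ring class
fields discharged. [cite: Jetchev2008, Prop. 5.3 (p. 823), Thm. 5.2 (p. 821)] [cite: McCallumLMS1991, §5 Prop. 5.2 (p. 304)] -/
theorem jetchevDivisibilityCarrierAdd_of_prop52_of_coreVertexExistence'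
    (h52 : McCallum1991.prop52_exists_conductor_kolyvaginClass_order_eq)
    (hCV : JetchevCoreVertexExistence)
    (H63 : ∀ (W : WeierstrassCurve ℚ) [W.IsElliptic] [W.IsGloballyMinimal] [NeZero (W.conductorNorm ℤ)],
      ¬ W.HasCM → ∀ (K : Type) [Field K] [NumberField K], IsImaginaryQuadratic K →
      NumberField.discr K ≠ -3 → NumberField.discr K ≠ -4 →
      SatisfiesHeegnerHypothesis (W.conductorNorm ℤ) K →
      ∀ (τ : K ≃ₐ[ℚ] K), τ ≠ 1 →
      ∀ (p : ℕ) [Fact p.Prime], p ≠ 2 →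
      ¬ W.HasGoodReductionAtPrime p → ¬ W.HasMultiplicativeReductionAtPrime p →
      (∀ n : ℕ, W.HasSurjectiveModNGaloisRep (p ^ n : ℕ)) →
      ∀ (Dt : ModularParametrizationData W (W.conductorNorm ℤ)) (β : ℤ) (ι : K →+* ℂ)
        [∀ k : ℕ, NumberField (ringClassField K ι k)]
        (d₁ : KolyvaginHeegnerData Dt β ι 1), ¬ IsOfFinAddOrder d₁.derivedPoint →
      ∀ (mdiv m : {c : ℕ // Squarefree c ∧ ∀ ℓ ∈ c.primeFactors,
          Zhang2014.IsKolyvaginPrime (W.conductorNorm ℤ) W K p ℓ} → ℕ∞),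
      (∀ c (u : ℕ), (u : ℕ∞) ≤ mdiv c ↔ ∀ d : KolyvaginHeegnerData Dt β ι c.1,
        ∃ Q : (W.baseChange (ringClassField K ι c.1)).toAffine.Point,
          ((p ^ u : ℕ) : ℤ) • Q = d.derivedPoint) →
      (∀ c, m c = if mdiv c < Zhang2014.levelIndex W p c.1 then mdiv c else ⊤) →
      ∀ mInf : ℕ, (∀ c, (mInf : ℕ∞) ≤ m c) →
        (∀ m' : ℕ, ∃ c, (m' : ℕ∞) ≤ Zhang2014.levelIndex W p c.1 ∧ m c = mInf) →
      ∀ (k : ℕ) c, 1 ≤ k → Jetchev2008.IsGlobalCoreVertex W K ι τ p k c.1 → m c = mInf →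
        (k : ℕ∞) + mInf ≤ Zhang2014.levelIndex W p c.1 →
        padicValNat p ((W.baseChange ℚ_[p]).localTamagawaNumber ℤ_[p]) < k → mInf < k →
        padicValNat p ((W.baseChange ℚ_[p]).localTamagawaNumber ℤ_[p]) ≤ mInf) :
    JetchevDivisibilityCarrierAdd :=
  jetchevDivisibilityCarrierAdd_of_prop52_of_coreVertexExistence h52 hCV
    (fun K _ _ ι hK ↦ numberField_ringClassField K hK ι) H63

end Summit.BirchSwinnertonDyer.Rank1Residual.JET

end
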